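import Summits.QuantumFields.YangMills.Theorems.SwapVirialDeficitZeroModeGroupThreeLaplaceRateLayers
import HarnessLib

/-!
# Exact zero-mode rung on the GROUP, three letters, Laplace form — IX: per-hub rate bound and the hub weight `(‖Im a‖²)^{−35/24}`
# (free-hands support of ⟨stmt-QuantumFields-24197⟩; quantifies w2 g55's chain I–V toward `|β²Λ₃(β) − v₃| ≤ K·β^{−θ}`)

Parts VI–VIII give, at an axis hub with `(A, r) = (‖a‖², ‖Im a‖)`, the two one-sided pointwise bounds `h_s ≤ h_0 + Δ₁`, `h_0 ≤ h_s + Δ₁ + Δ₂`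
(a.e.) and `∫∫Δ₁ + ∫∫Δ₂ ≤ C·s^θ·(r²)^{−(4/3+6θ)}`.  Here (θ = 1/48, so `4/3 + 6θ = 35/24 < 3/2`):
* §1 ★ `lintegral_ball_hub_rpow_lt_top` — the hub weight `(‖Im a‖²)^{−γ}` is integrable on the unit ball for every `0 ≤ γ < 3/2`
  (✓`rpow_neg_sum_three_le`: AM–GM into three `I(γ/3)`'s; w2 g55's ✓`lintegral_ball_hub_lt_top` is `γ = 4/3`);
* §2 ★★ `lintegral_hsc_le_add` / `lintegral_hsc_zero_le_add` — per hub: `∫∫h_s ≤ ∫∫h_0 + s^θ·E(a)` and `∫∫h_0 ≤ ∫∫h_s + s^θ·E(a)` with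
  `E(a) = rateCst·(‖Im a‖²)^{−35/24}`, and ★ `lintegral_cone_rateE_lt_top` — `∫ E dcone < ∞`.
Part X assembles the rate.  HONEST LABEL: finite-dimensional real analysis (plan-level zero-mode rung of a DRAFT line «sharp-sigma»); NOT the fixed-`L`
sharp law, NOT ⟨24197⟩; the Yang–Mills mass gap is NOT proved; no summit is proved by a line.  Width seat ym-line-sfw-p2-w2 g56 (cell ym-idea-1, free
hands; own crux ⟨22884⟩ blocked-on ⟨19935⟩), `--supports stmt-QuantumFields-24197`.  Standard axioms, 0 `sorry`.  References:
[cite: GonzalezarroyoAltes1988]; [cite: Vanbaal2001]; [folklore].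
-/

set_option autoImplicit false

noncomputable section

open MeasureTheory Quaternion Set Filter Topology
open scoped Quaternion ENNReal
open Literature.MathematicalPhysics.QuantumLattice
open Summit.QuantumFields.YangMills.Theorems.SwapTwistDeficit.ToronLog

attribute [local instance] Literature.Analysis.FluidPDE.Tao2016.quatMeasurableSpace
  Literature.Analysis.FluidPDE.Tao2016.quatBorelSpace
  Literature.MathematicalPhysics.QuantumLattice.secondCountableTopology_su2

namespace Summit.QuantumFields.YangMills.Theorems.SwapVirialDeficit.ZeroModeGroup

/-! ## §1 The hub weight `(‖Im a‖²)^{−γ}` for `γ < 3/2` -/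

/-- ★ The hub weight `(‖Im a‖²)^{−γ}` is integrable on the unit ball of `ℍ` for `0 ≤ γ`, `2γ/3 < 1` (AM–GM ⇒ three `I(γ/3)`'s). [folklore] -/
theorem lintegral_ball_hub_rpow_lt_top {γ : ℝ} (hγ0 : 0 < γ) (hγ : 2 * (γ / 3) < 1) :
    ∫⁻ a : ℍ, (Metric.ball (0:ℍ) 1).indicator (fun a => ENNReal.ofReal ((‖a.im‖ ^ 2) ^ (-γ))) a < ∞ := by
  set B : Set (ℝ × (ℝ × (ℝ × ℝ))) := {p | p.1 ^ 2 + p.2.1 ^ 2 + p.2.2.1 ^ 2 + p.2.2.2 ^ 2 < 1} with hB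
  set f : ℝ × (ℝ × (ℝ × ℝ)) → ℝ≥0∞ := fun p => B.indicator
      (fun p => ENNReal.ofReal ((p.2.1 ^ 2 + p.2.2.1 ^ 2 + p.2.2.2 ^ 2) ^ (-γ))) p with hf
  have hBm : MeasurableSet B := measurableSet_lt (by fun_prop) measurable_const
  have hfm : Measurable f :=
    (ENNReal.measurable_ofReal.comp ((by fun_prop : Measurable fun p : ℝ × (ℝ × (ℝ × ℝ)) =>
      p.2.1 ^ 2 + p.2.2.1 ^ 2 + p.2.2.2 ^ 2).pow_const _)).indicator hBm
  have he : ∀ a : ℍ, (Metric.ball (0:ℍ) 1).indicator (fun a => ENNReal.ofReal ((‖a.im‖ ^ 2) ^ (-γ))) a = f (coord4 a) := by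
    intro a
    have hmem : a ∈ Metric.ball (0:ℍ) 1 ↔ coord4 a ∈ B := by
      show a ∈ Metric.ball (0:ℍ) 1 ↔ a.re ^ 2 + a.imI ^ 2 + a.imJ ^ 2 + a.imK ^ 2 < 1
      rw [Metric.mem_ball, dist_zero_right, ← sq_norm_eq_sum_sq, pow_lt_one_iff_of_nonneg (norm_nonneg _) two_ne_zero]
    simp only [hf]
    by_cases hm : a ∈ Metric.ball (0:ℍ) 1
    · have him : ‖a.im‖ ^ 2 = a.imI ^ 2 + a.imJ ^ 2 + a.imK ^ 2 := by rw [sq_norm_eq_sum_sq]; simp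
      rw [indicator_of_mem hm, indicator_of_mem (hmem.1 hm), him]; rfl
    · rw [indicator_of_notMem hm, indicator_of_notMem (fun h => hm (hmem.2 h))]
  rw [lintegral_congr he, measurePreserving_coord4.lintegral_comp hfm]
  have hC : ENNReal.ofReal ((3:ℝ) ^ (-γ)) ≠ 0 := (ENNReal.ofReal_pos.2 (Real.rpow_pos_of_pos (by norm_num) _)).ne'
  have hbd : ∀ p, f p ≤ ENNReal.ofReal ((3:ℝ) ^ (-γ)) * ({u : ℝ | u ^ 2 < 1}.indicator (fun _ => (1:ℝ≥0∞)) p.1 *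
      ({u : ℝ | u ^ 2 < 1}.indicator (singPow (γ / 3)) p.2.1 * ({u : ℝ | u ^ 2 < 1}.indicator (singPow (γ / 3)) p.2.2.1 *
        {u : ℝ | u ^ 2 < 1}.indicator (singPow (γ / 3)) p.2.2.2))) := by
    intro p
    by_cases hm : p ∈ B
    swap
    · simp only [hf]; rw [indicator_of_notMem hm]; exact bot_le
    have hm' : p.1 ^ 2 + p.2.1 ^ 2 + p.2.2.1 ^ 2 + p.2.2.2 ^ 2 < 1 := hm
    have h0 : p.1 ∈ {u : ℝ | u ^ 2 < 1} := by
      show p.1 ^ 2 < 1; nlinarith [sq_nonneg p.2.1, sq_nonneg p.2.2.1, sq_nonneg p.2.2.2]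
    have h1 : p.2.1 ∈ {u : ℝ | u ^ 2 < 1} := by
      show p.2.1 ^ 2 < 1; nlinarith [sq_nonneg p.1, sq_nonneg p.2.2.1, sq_nonneg p.2.2.2]
    have h2 : p.2.2.1 ∈ {u : ℝ | u ^ 2 < 1} := by
      show p.2.2.1 ^ 2 < 1; nlinarith [sq_nonneg p.1, sq_nonneg p.2.1, sq_nonneg p.2.2.2]
    have h3 : p.2.2.2 ∈ {u : ℝ | u ^ 2 < 1} := by
      show p.2.2.2 ^ 2 < 1; nlinarith [sq_nonneg p.1, sq_nonneg p.2.1, sq_nonneg p.2.2.1]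
    simp only [hf]
    rw [indicator_of_mem hm, indicator_of_mem h0, indicator_of_mem h1, indicator_of_mem h2, indicator_of_mem h3, one_mul]
    by_cases z1 : p.2.1 = 0
    · rw [z1, singPow_zero, ENNReal.top_mul (mul_ne_zero (singPow_ne_zero _ _) (singPow_ne_zero _ _)), ENNReal.mul_top hC]
      exact le_top
    by_cases z2 : p.2.2.1 = 0
    · rw [z2, singPow_zero, ENNReal.top_mul (singPow_ne_zero _ _), ENNReal.mul_top (singPow_ne_zero _ _), ENNReal.mul_top hC]
      exact le_top
    by_cases z3 : p.2.2.2 = 0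
    · rw [z3, singPow_zero, ENNReal.mul_top (singPow_ne_zero _ _), ENNReal.mul_top (singPow_ne_zero _ _), ENNReal.mul_top hC]
      exact le_top
    rw [singPow_of_ne z1, singPow_of_ne z2, singPow_of_ne z3, ← ENNReal.ofReal_mul (Real.rpow_nonneg (sq_nonneg _) _),
      ← ENNReal.ofReal_mul (Real.rpow_nonneg (sq_nonneg _) _), ← ENNReal.ofReal_mul (Real.rpow_nonneg (by norm_num) _)]
    refine ENNReal.ofReal_le_ofReal ?_
    have := rpow_neg_sum_three_le (p := γ) (by positivity : 0 < p.2.1 ^ 2) (by positivity : 0 < p.2.2.1 ^ 2)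
      (by positivity : 0 < p.2.2.2 ^ 2) hγ0.le
    simpa only [mul_assoc] using this
  have hm3 : Measurable fun v : ℝ × ℝ => {u : ℝ | u ^ 2 < 1}.indicator (singPow (γ / 3)) v.1 * {u : ℝ | u ^ 2 < 1}.indicator (singPow (γ / 3)) v.2 :=
    ((measurable_boxSing _).comp measurable_fst).mul ((measurable_boxSing _).comp measurable_snd)
  have hm2 : Measurable fun u : ℝ × (ℝ × ℝ) => {u : ℝ | u ^ 2 < 1}.indicator (singPow (γ / 3)) u.1 *
      ({u : ℝ | u ^ 2 < 1}.indicator (singPow (γ / 3)) u.2.1 * {u : ℝ | u ^ 2 < 1}.indicator (singPow (γ / 3)) u.2.2) :=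
    ((measurable_boxSing _).comp measurable_fst).mul (hm3.comp measurable_snd)
  have hm1 : Measurable fun p : ℝ × (ℝ × (ℝ × ℝ)) => {u : ℝ | u ^ 2 < 1}.indicator (fun _ => (1:ℝ≥0∞)) p.1 *
      ({u : ℝ | u ^ 2 < 1}.indicator (singPow (γ / 3)) p.2.1 * ({u : ℝ | u ^ 2 < 1}.indicator (singPow (γ / 3)) p.2.2.1 *
        {u : ℝ | u ^ 2 < 1}.indicator (singPow (γ / 3)) p.2.2.2)) :=
    ((measurable_const.indicator measurableSet_sqLine).comp measurable_fst).mul (hm2.comp measurable_snd)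
  have hI := Ising_lt_top (c := γ / 3) (by positivity) hγ
  have h1 : ∫⁻ u, {u : ℝ | u ^ 2 < 1}.indicator (fun _ => (1:ℝ≥0∞)) u < ∞ := by
    rw [lintegral_indicator measurableSet_sqLine, setLIntegral_const, one_mul, volume_sqBox_one]; simp
  calc ∫⁻ p, f p ≤ ∫⁻ p : ℝ × (ℝ × (ℝ × ℝ)), ENNReal.ofReal ((3:ℝ) ^ (-γ)) * ({u : ℝ | u ^ 2 < 1}.indicator (fun _ => (1:ℝ≥0∞)) p.1 *
      ({u : ℝ | u ^ 2 < 1}.indicator (singPow (γ / 3)) p.2.1 * ({u : ℝ | u ^ 2 < 1}.indicator (singPow (γ / 3)) p.2.2.1 *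
        {u : ℝ | u ^ 2 < 1}.indicator (singPow (γ / 3)) p.2.2.2))) := lintegral_mono hbd
    _ = ENNReal.ofReal ((3:ℝ) ^ (-γ)) * ((∫⁻ u, {u : ℝ | u ^ 2 < 1}.indicator (fun _ => (1:ℝ≥0∞)) u) *
          (Ising (γ / 3) * (Ising (γ / 3) * Ising (γ / 3)))) := by
        rw [lintegral_const_mul _ hm1, lintegral_volume_prod_mul (measurable_const.indicator measurableSet_sqLine) hm2,
          lintegral_volume_prod_mul (measurable_boxSing _) hm3, lintegral_volume_prod_mul (measurable_boxSing _) (measurable_boxSing _)]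
        rfl
    _ < ∞ := ENNReal.mul_lt_top ENNReal.ofReal_lt_top (ENNReal.mul_lt_top h1 (ENNReal.mul_lt_top hI (ENNReal.mul_lt_top hI hI)))

/-- ★ `∫ (‖Im a‖²)^{−γ} dcone(a) < ∞` for `0 < γ`, `2γ/3 < 1`. [folklore] -/
theorem lintegral_cone_hub_rpow_lt_top {γ : ℝ} (hγ0 : 0 < γ) (hγ : 2 * (γ / 3) < 1) :
    ∫⁻ a, ENNReal.ofReal ((‖a.im‖ ^ 2) ^ (-γ)) ∂coneMeasure < ∞ := by
  rw [lintegral_coneMeasure_eq]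
  exact ENNReal.mul_lt_top ENNReal.ofReal_lt_top (lintegral_ball_hub_rpow_lt_top hγ0 hγ)

/-! ## §2 The per-hub rate bound -/

/-- The rate constant (θ = 1/48): `rateCst = (20^{1/48}·I(1/24)² + 8)·((π²/3)·I(1/3)²)`. [folklore] -/
def rateCst : ℝ≥0∞ :=
  (ENNReal.ofReal ((20:ℝ) ^ (1/48 : ℝ)) * (Ising (2 * (1/48 : ℝ)) * Ising (2 * (1/48 : ℝ))) + 8) *
    (ENNReal.ofReal (Real.pi ^ 2 / 3) * (Ising (1/3) * Ising (1/3)))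

/-- `rateCst < ∞`. [folklore] -/
theorem rateCst_lt_top : rateCst < ∞ := by
  have hI := Ising_lt_top (c := 1/3) (by norm_num) (by norm_num)
  have hI' := Ising_lt_top (c := 2 * (1/48 : ℝ)) (by norm_num) (by norm_num)
  unfold rateCst
  exact ENNReal.mul_lt_top (ENNReal.add_lt_top.2 ⟨ENNReal.mul_lt_top ENNReal.ofReal_lt_top (ENNReal.mul_lt_top hI' hI'), by simp⟩)
    (ENNReal.mul_lt_top ENNReal.ofReal_lt_top (ENNReal.mul_lt_top hI hI))

/-- The per-hub error weight `E(a) = rateCst·(‖Im a‖²)^{−35/24}`. [folklore] -/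
def rateE (a : ℍ) : ℝ≥0∞ := rateCst * ENNReal.ofReal ((‖a.im‖ ^ 2) ^ (-(35/24 : ℝ)))

/-- The hub weight is measurable. [folklore] -/
theorem measurable_hubWeight (γ : ℝ) : Measurable fun a : ℍ => ENNReal.ofReal ((‖a.im‖ ^ 2) ^ (-γ)) :=
  ENNReal.measurable_ofReal.comp (((Quaternion.continuous_im.norm).pow 2).measurable.pow_const _)

/-- `E` is measurable. [folklore] -/
theorem measurable_rateE : Measurable rateE := by
  unfold rateE; exact (measurable_hubWeight _).const_mul _

/-- ★ `∫ E dcone < ∞` (`35/24 < 3/2`). [folklore] -/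
theorem lintegral_cone_rateE_lt_top : ∫⁻ a, rateE a ∂coneMeasure < ∞ := by
  unfold rateE
  rw [lintegral_const_mul _ (measurable_hubWeight _)]
  exact ENNReal.mul_lt_top rateCst_lt_top (lintegral_cone_hub_rpow_lt_top (by norm_num) (by norm_num))

/-- The transverse block of parts VII–VIII at `p = 3θ = 1/16` collapses to `(π²/3)·I(1/3)²·(r²)^{−35/24}`. [folklore] -/
theorem block_eq {r : ℝ} (hr : 0 < r) :
    ENNReal.ofReal (16 * ((r ^ 2) ^ (-(3 * (1/48 : ℝ)))) ^ 2) * (ENNReal.ofReal (Real.pi ^ 2 / 48 * (r ^ 2) ^ (-(4/3 : ℝ))) * (Ising (1/3) * Ising (1/3))) =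
      (ENNReal.ofReal (Real.pi ^ 2 / 3) * (Ising (1/3) * Ising (1/3))) * ENNReal.ofReal ((r ^ 2) ^ (-(35/24 : ℝ))) := by
  have hr2 : 0 < r ^ 2 := by positivity
  have hpow : 16 * ((r ^ 2) ^ (-(3 * (1/48 : ℝ)))) ^ 2 * (Real.pi ^ 2 / 48 * (r ^ 2) ^ (-(4/3 : ℝ))) =
      Real.pi ^ 2 / 3 * (r ^ 2) ^ (-(35/24 : ℝ)) := by
    have e1 : ((r ^ 2) ^ (-(3 * (1/48 : ℝ)))) ^ 2 = (r ^ 2) ^ (-(1/8 : ℝ)) := by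
      rw [← Real.rpow_natCast, ← Real.rpow_mul hr2.le]; norm_num
    have e2 : (r ^ 2) ^ (-(1/8 : ℝ)) * (r ^ 2) ^ (-(4/3 : ℝ)) = (r ^ 2) ^ (-(35/24 : ℝ)) := by
      rw [← Real.rpow_add hr2]; norm_num
    rw [e1, ← e2]; ring
  rw [← mul_assoc, ← ENNReal.ofReal_mul (by positivity), hpow, ENNReal.ofReal_mul (by positivity)]
  ring

/-- The hub parameters of a good hub `a` (`‖a‖ < 1`, `a_J ≠ 0`): with `A = ‖axisPoint a‖²`, `r = (axisPoint a).imI = ‖Im a‖`: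
`0 < A ≤ 1`, `0 < r`, `r² ≤ A`, `r² ≤ 1`. [folklore] -/
theorem hub_params {a : ℍ} (ha : a ∈ Metric.ball (0:ℍ) 1) (hJ : a.imJ ≠ 0) :
    0 < ‖axisPoint a‖ ^ 2 ∧ ‖axisPoint a‖ ^ 2 ≤ 1 ∧ 0 < (axisPoint a).imI ∧ (axisPoint a).imI ^ 2 ≤ ‖axisPoint a‖ ^ 2 ∧
      (axisPoint a).imI ^ 2 ≤ 1 ∧ (axisPoint a).imI = ‖a.im‖ := by
  have hane : a ≠ 0 := fun h => hJ (by rw [h]; rfl)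
  rw [norm_axisPoint, (axisPoint_components a).2.1]
  have hlt : ‖a‖ < 1 := by rwa [Metric.mem_ball, dist_zero_right] at ha
  have hA1 : ‖a‖ ^ 2 ≤ 1 := by nlinarith [norm_nonneg a]
  have him : ‖a.im‖ ^ 2 ≤ ‖a‖ ^ 2 := by
    rw [WeakCouplingRates.sq_norm_im, sq_norm_eq_sum_sq]; nlinarith [sq_nonneg a.re]
  exact ⟨pow_pos (norm_pos_iff.2 hane) 2, hA1, norm_im_pos_of_imJ_ne_zero hJ, him, him.trans hA1, rfl⟩

/-- The two error integrals at a good hub are `≤ s^{1/48}·E(a)` (`0 < s ≤ 1`). [folklore] -/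
theorem lintegral_rateΔ_le {s : ℝ} (hs0 : 0 < s) (hs1 : s ≤ 1) {a : ℍ} (ha : a ∈ Metric.ball (0:ℍ) 1) (hJ : a.imJ ≠ 0) :
    (∫⁻ z, rateΔ₁ s (1/48 : ℝ) (axisPoint a).imI z.1 z.2 ∂((volume : Measure ℍ).prod volume)) +
        ∫⁻ z, rateΔ₂ s (axisPoint a).imI z.1 z.2 ∂((volume : Measure ℍ).prod volume) ≤
      ENNReal.ofReal (s ^ (1/48 : ℝ)) * rateE a := by
  obtain ⟨-, -, hr, -, hr1, hrim⟩ := hub_params ha hJ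
  have h1 := lintegral_rateΔ₁_le (θ := (1/48 : ℝ)) hs0.le hr hr1 (by norm_num) (by norm_num)
  have h2 := lintegral_rateΔ₂_le (p := 3 * (1/48 : ℝ)) hs0.le hr hr1 (by norm_num) (by norm_num)
  rw [block_eq hr] at h1 h2
  rw [hrim] at h1 h2
  -- `s^{3θ} ≤ s^θ`
  have hsθ : s ^ (3 * (1/48 : ℝ)) ≤ s ^ (1/48 : ℝ) := Real.rpow_le_rpow_of_exponent_ge hs0 hs1 (by norm_num)
  have h2' : ∫⁻ z, rateΔ₂ s ‖a.im‖ z.1 z.2 ∂((volume : Measure ℍ).prod volume) ≤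
      2 * (4 * ENNReal.ofReal (s ^ (1/48 : ℝ)) * ((ENNReal.ofReal (Real.pi ^ 2 / 3) * (Ising (1/3) * Ising (1/3))) *
        ENNReal.ofReal ((‖a.im‖ ^ 2) ^ (-(35/24 : ℝ))))) :=
    h2.trans (mul_le_mul' le_rfl (mul_le_mul' (mul_le_mul' le_rfl (ENNReal.ofReal_le_ofReal hsθ)) le_rfl))
  have h1' : ∫⁻ z, rateΔ₁ s (1/48 : ℝ) ‖a.im‖ z.1 z.2 ∂((volume : Measure ℍ).prod volume) ≤
      ENNReal.ofReal (s ^ (1/48 : ℝ)) * (ENNReal.ofReal ((20:ℝ) ^ (1/48 : ℝ)) * ((Ising (2 * (1/48 : ℝ)) * Ising (2 * (1/48 : ℝ))) *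
        ((ENNReal.ofReal (Real.pi ^ 2 / 3) * (Ising (1/3) * Ising (1/3))) * ENNReal.ofReal ((‖a.im‖ ^ 2) ^ (-(35/24 : ℝ)))))) := by
    refine h1.trans (le_of_eq ?_)
    rw [ENNReal.ofReal_mul (Real.rpow_nonneg hs0.le _)]; ring
  refine (add_le_add h1' h2').trans (le_of_eq ?_)
  unfold rateE rateCst
  ring

/-- Off a `vol ⊗ vol`-null set both letters have `x₀², y₀² > 0`, hence `N_0 > 0`. [folklore] -/
theorem ae_longitudinal_pos :
    ∀ᵐ z : ℍ × ℍ ∂((volume : Measure ℍ).prod volume), 0 < z.1.re ^ 2 + z.1.imI ^ 2 ∧ 0 < z.2.re ^ 2 + z.2.imI ^ 2 := by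
  filter_upwards [ae_nsc_zero_ne] with z hz
  rw [nsc_zero, nsc_zero] at hz
  exact ⟨lt_of_le_of_ne (by positivity) (Ne.symm hz.1), lt_of_le_of_ne (by positivity) (Ne.symm hz.2)⟩

/-- ★★ **PER-HUB UPPER BOUND**: `∫∫ h_s ≤ ∫∫ h_0 + s^{1/48}·E(a)` at a good hub (`0 < s ≤ 1`). [folklore] -/
theorem lintegral_hsc_le_add {s : ℝ} (hs0 : 0 < s) (hs1 : s ≤ 1) {a : ℍ} (ha : a ∈ Metric.ball (0:ℍ) 1) (hJ : a.imJ ≠ 0) :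
    ∫⁻ z, hsc s (‖axisPoint a‖ ^ 2) (axisPoint a).imI z.1 z.2 ∂((volume : Measure ℍ).prod volume) ≤
      (∫⁻ z, hsc 0 (‖axisPoint a‖ ^ 2) (axisPoint a).imI z.1 z.2 ∂((volume : Measure ℍ).prod volume)) + ENNReal.ofReal (s ^ (1/48 : ℝ)) * rateE a := by
  obtain ⟨hA0, hA1, hr, hrA, -, -⟩ := hub_params ha hJ
  calc ∫⁻ z, hsc s (‖axisPoint a‖ ^ 2) (axisPoint a).imI z.1 z.2 ∂((volume : Measure ℍ).prod volume)
      ≤ ∫⁻ z, hsc 0 (‖axisPoint a‖ ^ 2) (axisPoint a).imI z.1 z.2 + rateΔ₁ s (1/48 : ℝ) (axisPoint a).imI z.1 z.2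
          ∂((volume : Measure ℍ).prod volume) := by
        refine lintegral_mono_ae ?_
        filter_upwards [ae_longitudinal_pos] with z hz
        exact hsc_le_hsc_zero_add hs0 hs1 hA0 hA1 hrA (by norm_num) (by norm_num) hz.1 hz.2
    _ = (∫⁻ z, hsc 0 (‖axisPoint a‖ ^ 2) (axisPoint a).imI z.1 z.2 ∂((volume : Measure ℍ).prod volume)) +
          ∫⁻ z, rateΔ₁ s (1/48 : ℝ) (axisPoint a).imI z.1 z.2 ∂((volume : Measure ℍ).prod volume) :=
        lintegral_add_left (measurable_hsc_uncurry 0 _ _) _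
    _ ≤ _ := by
        refine add_le_add le_rfl ((le_self_add).trans (lintegral_rateΔ_le hs0 hs1 ha hJ))

/-- ★★ **PER-HUB LOWER BOUND**: `∫∫ h_0 ≤ ∫∫ h_s + s^{1/48}·E(a)` at a good hub (`0 < s ≤ 1`). [folklore] -/
theorem lintegral_hsc_zero_le_add {s : ℝ} (hs0 : 0 < s) (hs1 : s ≤ 1) {a : ℍ} (ha : a ∈ Metric.ball (0:ℍ) 1) (hJ : a.imJ ≠ 0) :
    ∫⁻ z, hsc 0 (‖axisPoint a‖ ^ 2) (axisPoint a).imI z.1 z.2 ∂((volume : Measure ℍ).prod volume) ≤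
      (∫⁻ z, hsc s (‖axisPoint a‖ ^ 2) (axisPoint a).imI z.1 z.2 ∂((volume : Measure ℍ).prod volume)) + ENNReal.ofReal (s ^ (1/48 : ℝ)) * rateE a := by
  obtain ⟨hA0, hA1, hr, hrA, -, -⟩ := hub_params ha hJ
  calc ∫⁻ z, hsc 0 (‖axisPoint a‖ ^ 2) (axisPoint a).imI z.1 z.2 ∂((volume : Measure ℍ).prod volume)
      ≤ ∫⁻ z, hsc s (‖axisPoint a‖ ^ 2) (axisPoint a).imI z.1 z.2 + rateΔ₁ s (1/48 : ℝ) (axisPoint a).imI z.1 z.2 +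
          rateΔ₂ s (axisPoint a).imI z.1 z.2 ∂((volume : Measure ℍ).prod volume) := by
        refine lintegral_mono_ae ?_
        filter_upwards [ae_longitudinal_pos] with z hz
        exact hsc_zero_le_hsc_add hs0 hs1 hA0 hA1 hrA (by norm_num) (by norm_num) hz.1 hz.2
    _ = (∫⁻ z, hsc s (‖axisPoint a‖ ^ 2) (axisPoint a).imI z.1 z.2 ∂((volume : Measure ℍ).prod volume)) +
          ((∫⁻ z, rateΔ₁ s (1/48 : ℝ) (axisPoint a).imI z.1 z.2 ∂((volume : Measure ℍ).prod volume)) +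
            ∫⁻ z, rateΔ₂ s (axisPoint a).imI z.1 z.2 ∂((volume : Measure ℍ).prod volume)) := by
        have hm : Measurable fun z : ℍ × ℍ => hsc s (‖axisPoint a‖ ^ 2) (axisPoint a).imI z.1 z.2 + rateΔ₁ s (1/48 : ℝ) (axisPoint a).imI z.1 z.2 :=
          (measurable_hsc_uncurry s _ _).add (measurable_rateΔ₁_uncurry s _ _)
        rw [lintegral_add_left hm, lintegral_add_left (measurable_hsc_uncurry s _ _), add_assoc]
    _ ≤ _ := add_le_add le_rfl (lintegral_rateΔ_le hs0 hs1 ha hJ)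

end Summit.QuantumFields.YangMills.Theorems.SwapVirialDeficit.ZeroModeGroup

end
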